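import Mathlib

/-!
# Overlap outside a threshold (Ferrers) relation costs half its square

Crux `Summit.MatrixMultiplication.MatrixMultiplication.Theses.SnSubsetDichotomy.PolynomialSlack`
(item `stmt-MatrixMultiplication-8306`), line transport-split-hull (lead c9, all-split endgame):
the Ferrers/overlap accounting lemma `sum_mul_le_of_threshold_overlap`.

Two families of positive reals `x : α → ℝ`, `y : β → ℝ` and a threshold `A` define the
"productive" relation `D a b :⟺ x a * y b ≤ A`; since `log x + log y` has additive rank one this is
a threshold (Ferrers) relation.  Given masses `σ, ρ` dominating the row and column sums of a
non-negative overlap kernel `h`, the productive pairs carry at most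
`(∑ σ) * (∑ ρ) - H ^ 2 / 2`, where `H` is the overlap mass sitting outside `D`:
the threshold structure forces, for every two overlap cells outside `D`, at least one of the two
"cross" cells to lie outside `D` as well (the same-product trick
`(x a * y b) * (x a' * y b') = (x a * y b') * (x a' * y b)`), so at least half of `H ^ 2` is paid for
by unproductive mass.
-/

namespace Summit.MatrixMultiplication.MatrixMultiplication.Theorems.PolynomialSlack

set_option linter.dupNamespace false

open scoped BigOperators

/-- The same-product trick: for positive reals, if `x a * y b' > A` and `x a' * y b > A` then the
two cross products `x a * y b`, `x a' * y b'` cannot both be `≤ A`, because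
`(x a * y b) * (x a' * y b') = (x a * y b') * (x a' * y b)`. [folklore] -/
private theorem not_le_or_not_le_of_lt_cross {u u' v v' A : ℝ} (hu : 0 < u) (hu' : 0 < u')
    (hv : 0 < v) (hv' : 0 < v') (h1 : A < u * v') (h2 : A < u' * v) :
    ¬ (u * v ≤ A) ∨ ¬ (u' * v' ≤ A) := by
  by_cases h3 : u * v ≤ A
  · by_cases h4 : u' * v' ≤ A
    · exfalso
      have hA : 0 < A := lt_of_lt_of_le (mul_pos hu hv) h3
      have h5 : (u * v) * (u' * v') ≤ A * A := mul_le_mul h3 h4 (mul_pos hu' hv').le hA.le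
      have h6 : A * A < (u * v') * (u' * v) := mul_lt_mul'' h1 h2 hA.le hA.le
      have h7 : (u * v) * (u' * v') = (u * v') * (u' * v) := by ring
      linarith
    · exact Or.inr h4
  · exact Or.inl h3

/-- Abstract half-square lemma: if a non-negative weight `G` on a finite type and a decidable
relation `S` are such that any two cells of positive weight `p, q` have `¬ S p q ∨ ¬ S q p`, then
`(∑ G) ^ 2 ≤ 2 * ∑_{p,q, ¬ S p q} G p * G q` (pair each ordered pair with its reverse).
[folklore] -/
private theorem sq_sum_le_two_mul_sum_ite {P : Type*} [Fintype P] (S : P → P → Prop)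
    [∀ p q, Decidable (S p q)] (G : P → ℝ) (hG : ∀ p, 0 ≤ G p)
    (hS : ∀ p q, 0 < G p → 0 < G q → ¬ S p q ∨ ¬ S q p) :
    (∑ p, G p) ^ 2 ≤ 2 * ∑ p, ∑ q, (if S p q then 0 else G p * G q) := by
  have key : ∀ p q,
      G p * G q ≤ (if S p q then 0 else G p * G q) + (if S q p then 0 else G q * G p) := by
    intro p q
    by_cases hp : 0 < G p
    · by_cases hq : 0 < G q
      · rcases hS p q hp hq with h1 | h1
        · rw [if_neg h1]
          split_ifs <;> nlinarith [mul_nonneg (hG p) (hG q), mul_comm (G q) (G p)]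
        · rw [if_neg h1]
          split_ifs <;> nlinarith [mul_nonneg (hG p) (hG q), mul_comm (G q) (G p)]
      · have hq0 : G q = 0 := le_antisymm (not_lt.mp hq) (hG q)
        simp [hq0]
    · have hp0 : G p = 0 := le_antisymm (not_lt.mp hp) (hG p)
      simp [hp0]
  calc (∑ p, G p) ^ 2 = ∑ p, ∑ q, G p * G q := by rw [sq, Finset.sum_mul_sum]
    _ ≤ ∑ p, ∑ q, ((if S p q then 0 else G p * G q) + (if S q p then 0 else G q * G p)) :=
        Finset.sum_le_sum fun p _ => Finset.sum_le_sum fun q _ => key p q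
    _ = ∑ p, ∑ q, (if S p q then 0 else G p * G q)
          + ∑ p, ∑ q, (if S q p then 0 else G q * G p) := by
        rw [← Finset.sum_add_distrib]
        exact Finset.sum_congr rfl fun p _ => Finset.sum_add_distrib
    _ = ∑ p, ∑ q, (if S p q then 0 else G p * G q)
          + ∑ p, ∑ q, (if S p q then 0 else G p * G q) := by
        congr 1
        exact Finset.sum_comm
    _ = 2 * ∑ p, ∑ q, (if S p q then 0 else G p * G q) := by ring

/-- Nested (two-index) form of the half-square lemma: for a non-negative kernel `g : α → β → ℝ`
and a decidable relation `D` such that `0 < g a b'`, `0 < g a' b` force `¬ D a b ∨ ¬ D a' b'`,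
`(∑∑ g) ^ 2 ≤ 2 * ∑_{a,b, ¬ D a b} (∑_{b'} g a b') * (∑_{a'} g a' b)`. [folklore] -/
private theorem sq_sum_sum_le_two_mul {α β : Type*} [Fintype α] [Fintype β] (D : α → β → Prop)
    [∀ a b, Decidable (D a b)] (g : α → β → ℝ) (hg0 : ∀ a b, 0 ≤ g a b)
    (hD : ∀ a b a' b', 0 < g a b' → 0 < g a' b → ¬ D a b ∨ ¬ D a' b') :
    (∑ a, ∑ b, g a b) ^ 2
      ≤ 2 * ∑ a, ∑ b, (if D a b then 0 else (∑ b', g a b') * (∑ a', g a' b)) := by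
  have key := sq_sum_le_two_mul_sum_ite (P := α × β) (fun p q => D p.1 q.2) (fun p => g p.1 p.2)
    (fun p => hg0 p.1 p.2) (fun p q hp hq => hD p.1 q.2 q.1 p.2 hp hq)
  rw [Fintype.sum_prod_type, Fintype.sum_prod_type] at key
  simp only [Fintype.sum_prod_type_right] at key
  calc (∑ a, ∑ b, g a b) ^ 2
        ≤ 2 * ∑ a, ∑ b', ∑ b, ∑ a', (if D a b then 0 else g a b' * g a' b) := key
    _ = 2 * ∑ a, ∑ b, ∑ b', ∑ a', (if D a b then 0 else g a b' * g a' b) := by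
        congr 1
        exact Finset.sum_congr rfl fun a _ => Finset.sum_comm
    _ = 2 * ∑ a, ∑ b, (if D a b then 0 else (∑ b', g a b') * (∑ a', g a' b)) := by
        congr 1
        refine Finset.sum_congr rfl fun a _ => Finset.sum_congr rfl fun b _ => ?_
        by_cases hab : D a b
        · simp [hab]
        · simp only [hab, if_false]
          rw [Finset.sum_mul_sum]

/-- The overlap endgame in abstract form: if `g ≥ 0` has row sums `≤ σ`, column sums `≤ ρ`, and
positive cells `g a b'`, `g a' b` force `¬ D a b ∨ ¬ D a' b'`, then
`(∑∑ g) ^ 2 / 2 ≤ ∑_{a,b, ¬ D a b} σ a * ρ b`. [folklore] -/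
private theorem sq_sum_sum_div_two_le {α β : Type*} [Fintype α] [Fintype β] (D : α → β → Prop)
    [∀ a b, Decidable (D a b)] (g : α → β → ℝ) (hg0 : ∀ a b, 0 ≤ g a b) (σ : α → ℝ)
    (ρ : β → ℝ) (hσ : ∀ a, ∑ b, g a b ≤ σ a) (hρ : ∀ b, ∑ a, g a b ≤ ρ b)
    (hD : ∀ a b a' b', 0 < g a b' → 0 < g a' b → ¬ D a b ∨ ¬ D a' b') :
    (∑ a, ∑ b, g a b) ^ 2 / 2 ≤ ∑ a, ∑ b, (if D a b then 0 else σ a * ρ b) := by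
  have hχ0 : ∀ a, 0 ≤ ∑ b, g a b := fun a => Finset.sum_nonneg fun b _ => hg0 a b
  have hχ'0 : ∀ b, 0 ≤ ∑ a, g a b := fun b => Finset.sum_nonneg fun a _ => hg0 a b
  have step : ∑ a, ∑ b, (if D a b then 0 else (∑ b', g a b') * (∑ a', g a' b))
      ≤ ∑ a, ∑ b, (if D a b then 0 else σ a * ρ b) := by
    refine Finset.sum_le_sum fun a _ => Finset.sum_le_sum fun b _ => ?_
    split_ifs
    · exact le_rfl
    · exact mul_le_mul (hσ a) (hρ b) (hχ'0 b) ((hχ0 a).trans (hσ a))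
  have key := sq_sum_sum_le_two_mul D g hg0 hD
  linarith

/-- **Ferrers/overlap lemma** (all-split endgame of the polynomial-slack thesis).  Let
`x : α → ℝ`, `y : β → ℝ` be positive, `A` a threshold, `h ≥ 0` an overlap kernel whose row sums are
`≤ σ` and column sums `≤ ρ`.  Writing `D a b :⟺ x a * y b ≤ A` for the productive pairs and
`H := ∑_{a,b, ¬ D a b} h a b` for the overlap outside `D`, one has
`∑_{D a b} σ a * ρ b + H ^ 2 / 2 ≤ (∑ σ) * (∑ ρ)`: since `D` is a threshold relation for the
rank-one quantity `x a * y b`, of any two overlap cells `(a,b'), (a',b)` outside `D` at least one of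
the cross cells `(a,b), (a',b')` is outside `D`, so half of `H ^ 2` is unproductive. [folklore] -/
theorem sum_mul_le_of_threshold_overlap {α β : Type*} [Fintype α] [Fintype β] [DecidableEq α]
    [DecidableEq β] (x : α → ℝ) (y : β → ℝ) (A : ℝ) (hx : ∀ a, 0 < x a) (hy : ∀ b, 0 < y b)
    (σ : α → ℝ) (ρ : β → ℝ) (h : α → β → ℝ) (hh0 : ∀ a b, 0 ≤ h a b)
    (hσ : ∀ a, ∑ b, h a b ≤ σ a) (hρ : ∀ b, ∑ a, h a b ≤ ρ b) :
    ∑ a, ∑ b, (if x a * y b ≤ A then σ a * ρ b else 0)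
        + (∑ a, ∑ b, (if x a * y b ≤ A then 0 else h a b)) ^ 2 / 2
      ≤ (∑ a, σ a) * (∑ b, ρ b) := by
  -- split `(∑ σ) * (∑ ρ)` along the decidable relation `x a * y b ≤ A`
  have hsplit : (∑ a, σ a) * (∑ b, ρ b)
      = ∑ a, ∑ b, (if x a * y b ≤ A then σ a * ρ b else 0)
        + ∑ a, ∑ b, (if x a * y b ≤ A then 0 else σ a * ρ b) := by
    rw [Finset.sum_mul_sum, ← Finset.sum_add_distrib]
    refine Finset.sum_congr rfl fun a _ => ?_
    rw [← Finset.sum_add_distrib]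
    refine Finset.sum_congr rfl fun b _ => ?_
    split_ifs <;> simp
  rw [hsplit, add_le_add_iff_left]
  -- the overlap outside the productive region, `g a b := if x a * y b ≤ A then 0 else h a b`
  have hg0 : ∀ a b, 0 ≤ (if x a * y b ≤ A then 0 else h a b) := fun a b => by
    split_ifs
    exacts [le_rfl, hh0 a b]
  have hgh : ∀ a b, (if x a * y b ≤ A then 0 else h a b) ≤ h a b := fun a b => by
    split_ifs
    exacts [hh0 a b, le_rfl]
  have hχσ : ∀ a, ∑ b, (if x a * y b ≤ A then 0 else h a b) ≤ σ a := fun a =>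
    (Finset.sum_le_sum fun b _ => hgh a b).trans (hσ a)
  have hχρ : ∀ b, ∑ a, (if x a * y b ≤ A then 0 else h a b) ≤ ρ b := fun b =>
    (Finset.sum_le_sum fun a _ => hgh a b).trans (hρ b)
  -- the threshold structure: two overlap cells outside `D` have a cross cell outside `D`
  have hD : ∀ a b a' b', 0 < (if x a * y b' ≤ A then 0 else h a b') →
      0 < (if x a' * y b ≤ A then 0 else h a' b) → ¬ (x a * y b ≤ A) ∨ ¬ (x a' * y b' ≤ A) := by
    intro a b a' b' h1 h2
    have h1' : A < x a * y b' := by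
      by_contra hc
      rw [if_pos (not_lt.mp hc)] at h1
      exact lt_irrefl _ h1
    have h2' : A < x a' * y b := by
      by_contra hc
      rw [if_pos (not_lt.mp hc)] at h2
      exact lt_irrefl _ h2
    exact not_le_or_not_le_of_lt_cross (hx a) (hx a') (hy b) (hy b') h1' h2'
  exact sq_sum_sum_div_two_le (D := fun a b => x a * y b ≤ A)
    (g := fun a b => if x a * y b ≤ A then 0 else h a b) hg0 σ ρ hχσ hχρ hD

end Summit.MatrixMultiplication.MatrixMultiplication.Theorems.PolynomialSlack
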